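import Literature.Combinatorics.SimpleGraph.OrderedRefinementStable
import Literature.Computability.Complexity.GraphCanonizationSchemeEquiv
import HarnessLib

/-!
# Ordered colour refinement on a vertex subset is a refiner (for the section/individualization canoniser)

The concrete `CGCanon.Refiner` (`GraphCanonizationScheme.lean`) used by the simply-exponential
canoniser: on a state `(W, c)` run the tree's ORDERED COLOUR REFINEMENT
(`Literature/Combinatorics/SimpleGraph/ColourRefinementOrder.lean`, `OrderedRefinementStable.lean`:
one round `ocrStep`, `t` rounds `ocrIter`) on the state graph `within G W` started from the
lifted colouring `liftCol W c`, for `k` rounds: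

* `CGCanon.crRefine G W c := ocrIter (within G W) (liftCol W c) k`;
* it refines `c` on `W` (`eq_of_ocrIter_eq`), it is equitable on `W` (`isEquitable_ocrIter`
  — `k` rounds stabilise a `k`-vertex graph — transported to the lifted output colouring, whose
  kernel is the same: the vertices off `W` are isolated of colour `0` and stay one class,
  `ocrIter_eq_of_not_mem`), and it is label-invariant (`ocrStep_comap`,
  `ColourRefinementScheme.lean`, iterated: `ocrIter_comap'`);
* **`CGCanon.crRefiner k : Refiner k`**.

## References

* B. D. McKay, A. Piperno, *Practical graph isomorphism, II*, J. Symbolic Comput. 60 (2014),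
  §2.3 ((R1)–(R3)), §3.1. [MckayPiperno2014]
* B. Laubner, PhD thesis, HU Berlin 2011, doi:10.18452/16335, §3.4 step 1. [Laubner2011]
-/

namespace Literature.Computability.Complexity

open Literature.Combinatorics.SimpleGraph Finset ColourRefinementScheme

open scoped Classical

noncomputable section

namespace CGCanon

variable {k : ℕ}

/-- **The refinement operator**: `k` rounds of ordered colour refinement of the state graph
`within G W` from the lifted colouring. [cite: MckayPiperno2014, §3.1] -/
def crRefine (G : SimpleGraph (Fin k)) (W : Finset (Fin k)) (c : Fin k → ℕ) : Fin k → ℕ :=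
  ocrIter (within G W) (liftCol W c) k

/-! ### One round is label-invariant for any pair of corresponding graphs -/

/-- `ocrStep` along corresponding graphs (any decidability instances): if `H' = H.comap e` then
`ocrStep H' (col ∘ e) = ocrStep H col ∘ e`. [cite: MckayPiperno2014, §3.1] -/
theorem ocrStep_comap' {H H' : SimpleGraph (Fin k)} [DecidableRel H.Adj] [DecidableRel H'.Adj] (e : Equiv.Perm (Fin k))
    (hH : H' = H.comap e) (col : Fin k → ℕ) : ocrStep H' (col ∘ e) = ocrStep H col ∘ e := by
  subst hH
  exact ocrStep_comap H e col

/-- `ocrIter` along corresponding graphs. [cite: MckayPiperno2014, §3.1] -/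
theorem ocrIter_comap' {H H' : SimpleGraph (Fin k)} [DecidableRel H.Adj] [DecidableRel H'.Adj] (e : Equiv.Perm (Fin k))
    (hH : H' = H.comap e) (col : Fin k → ℕ) : ∀ t : ℕ, ocrIter H' (col ∘ e) t = ocrIter H col t ∘ e
  | 0 => rfl
  | t + 1 => by rw [ocrIter_succ, ocrIter_succ, ocrIter_comap' e hH col t, ocrStep_comap' e hH]

/-! ### Vertices off `W` -/

/-- Two isolated vertices of the same colour get the same colour in every round. [folklore] -/
theorem ocrIter_eq_of_isolated {H : SimpleGraph (Fin k)} [DecidableRel H.Adj] {col : Fin k → ℕ} {u v : Fin k}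
    (hu : ∀ w, ¬ H.Adj u w) (hv : ∀ w, ¬ H.Adj v w) (huv : col u = col v) : ∀ t : ℕ, ocrIter H col t u = ocrIter H col t v
  | 0 => huv
  | t + 1 => by
    rw [ocrIter_succ]
    refine ocrStep_eq_iff.2 ⟨ocrIter_eq_of_isolated hu hv huv t, fun w => ?_⟩
    unfold nbrCount
    rw [filter_eq_empty_iff.2 fun x _ hx => hu x hx.1, filter_eq_empty_iff.2 fun x _ hx => hv x hx.1]

variable {G : SimpleGraph (Fin k)} {W : Finset (Fin k)} {c : Fin k → ℕ}

/-- Off `W` the refined colouring is constant. [folklore] -/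
theorem crRefine_eq_of_not_mem {u v : Fin k} (hu : u ∉ W) (hv : v ∉ W) : crRefine G W c u = crRefine G W c v :=
  ocrIter_eq_of_isolated (fun w h => hu (within_adj.1 h).1) (fun w h => hv (within_adj.1 h).1)
    (by rw [liftCol_of_not_mem c hu, liftCol_of_not_mem c hv]) k

/-- The refined colouring refines the lifted one (everywhere). [cite: MckayPiperno2014, §2.3 (R1)] -/
theorem liftCol_eq_of_crRefine_eq {u v : Fin k} (h : crRefine G W c u = crRefine G W c v) : liftCol W c u = liftCol W c v :=
  eq_of_ocrIter_eq h

/-- Hence a refined colour worn on `W` is not worn off `W`. [folklore] -/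
theorem crRefine_ne_of_mem_of_not_mem {u v : Fin k} (hu : u ∈ W) (hv : v ∉ W) : crRefine G W c u ≠ crRefine G W c v := fun h => by
  have := liftCol_eq_of_crRefine_eq h
  rw [liftCol_of_mem c hu, liftCol_of_not_mem c hv] at this
  exact Nat.succ_ne_zero _ this

/-- **The refined colouring and its lift have the same kernel.** [folklore] -/
theorem crRefine_eq_iff_liftCol_eq (u v : Fin k) :
    crRefine G W c u = crRefine G W c v ↔ liftCol W (crRefine G W c) u = liftCol W (crRefine G W c) v := by
  by_cases hu : u ∈ W
  · by_cases hv : v ∈ W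
    · rw [liftCol_eq_liftCol_iff hu hv]
    · rw [liftCol_of_mem _ hu, liftCol_of_not_mem _ hv]
      exact iff_of_false (crRefine_ne_of_mem_of_not_mem hu hv) (Nat.succ_ne_zero _)
  · by_cases hv : v ∈ W
    · rw [liftCol_of_not_mem _ hu, liftCol_of_mem _ hv]
      exact iff_of_false (fun h => crRefine_ne_of_mem_of_not_mem hv hu h.symm) fun h => Nat.succ_ne_zero _ h.symm
    · rw [liftCol_of_not_mem _ hu, liftCol_of_not_mem _ hv]
      exact iff_of_true (crRefine_eq_of_not_mem hu hv) rfl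

/-! ### The three laws -/

/-- **(refines)** On `W` the refined colouring refines `c`. [cite: MckayPiperno2014, §2.3 (R1)] -/
theorem crRefine_refines {u v : Fin k} (hu : u ∈ W) (hv : v ∈ W) (h : crRefine G W c u = crRefine G W c v) : c u = c v :=
  (liftCol_eq_liftCol_iff hu hv).1 (liftCol_eq_of_crRefine_eq h)

/-- **(equitable)** The refined state is equitable: `k` rounds stabilise (`isEquitable_ocrIter`),
and the lift of the output has the same kernel as the output. [cite: MckayPiperno2014, §2.3 (equitable partitions)] -/
theorem crRefine_isEqui : IsEqui G W (crRefine G W c) := by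
  have h : IsEquitable (within G W) (crRefine G W c) := isEquitable_ocrIter (liftCol W c) (by simp)
  exact h.congr_ker crRefine_eq_iff_liftCol_eq

/-- **(label-invariance)**, pullback form on `W`. [cite: MckayPiperno2014, §2.3 (R3)] -/
theorem crRefine_equivariant (G : SimpleGraph (Fin k)) (e : Equiv.Perm (Fin k)) (W : Finset (Fin k)) (c c' : Fin k → ℕ)
    (hc : ∀ v ∈ W, c' v = c (e v)) (v : Fin k) : crRefine (G.comap e) W c' v = crRefine G (W.map e.toEmbedding) c (e v) := by
  have hg : within (G.comap e) W = (within G (W.map e.toEmbedding)).comap e := by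
    ext a b; rw [SimpleGraph.comap_adj]; exact within_comap_adj a b
  have hl : liftCol W c' = liftCol (W.map e.toEmbedding) c ∘ e := funext (liftCol_comap hc)
  unfold crRefine
  rw [hl, ocrIter_comap' e hg]
  rfl

variable (k)

/-- **Ordered colour refinement on subsets is a refiner** for the section/individualization
canoniser. [cite: MckayPiperno2014, §2.3 and §3.1] -/
def crRefiner : Refiner k where
  refine := crRefine
  refines := fun _ _ _ _ _ hu hv h => crRefine_refines hu hv h
  isEqui := fun _ _ _ => crRefine_isEqui
  equivariant := fun G e W c c' hc v _ => crRefine_equivariant G e W c c' hc v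

end CGCanon

end

end Literature.Computability.Complexity
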